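import Summits.KontsevichZagierPeriods.KontsevichZagierPeriods.Theorems.HurwitzMicroSectorsNormalFormPrincipleAlgCarriers
import Summits.KontsevichZagierPeriods.KontsevichZagierPeriods.Theorems.AbelContractionRealHyperellipticSectorPortDlogMoves
import Summits.KontsevichZagierPeriods.KontsevichZagierPeriods.Theorems.AbelContractionRealHyperellipticSectorPortAlgDlogMoves
import Summits.KontsevichZagierPeriods.KontsevichZagierPeriods.Theorems.AbelContractionRealHyperellipticSectorPortCarrierAMulSiegeK8

/-!
# Route AbelContraction — `RealHyperellipticSector` (crux stmt-KontsevichZagierPeriods-12475):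
# the dimension-certified port, layer 3 — the calculus of the dlog carriers `Λ(a,b,c)`

Helper file of the line `Lines/birth.lean` (stub `stub_bakerAlg`, `--supports` the crux): the port
of `Theorems/HurwitzMicroSectorsNormalFormPrincipleAlgCarriers.lean` (namespace
`…NormalFormPrinciple.PiBox.Dlog`) INTO THE BUDGET `KZ.relationsLE 1`: the calculus of a fixed
family of dlog carriers `RA a b c = [(a,b), c/y]` with real algebraic data modulo the TRUNCATED
relations `relationsLE 1` (classes in `FormalRep ⧸ relationsLE 1`) — empty carrier, powers
(`carrierA_pow_eq`, from the budget multiplicativity `Port.Dlog.CarrierSiegeK8.carrierA_mul_mem_relationsLE`),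
additivity and `ℤ`-linearity in `c`, finite sums, and `carrierA_interval_eq`
(`[(a,b), c/y] = Λ(b/a, c)`, registered sub-goal; one scaling move in dimension `1`).
Every move is among representations of dimension `1` (rules 1, 2).

The dimension-free lemmas of the original (`isAlgebraic_aevalK`, `exists_ptCarrierA`,
`exists_carrierA`) are reused by importing it; names and hypotheses are those of the original
with `relations ↦ relationsLE` (`relationsLE 1` in the quotients).

Sources: M. Kontsevich, D. Zagier, *Periods* (2001), §1.2 rules (1), (2) [KontsevichZagier2001].
No definitions are introduced.
-/

noncomputable section

open MeasureTheory Set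
open scoped Polynomial
open Literature.NumberTheory.Transcendental Literature.NumberTheory.Transcendental.KZ
open Literature.ModelTheory.ExponentialFields (IsSemialgebraic isSemialgebraic_univ)

namespace Summit.KontsevichZagierPeriods.AbelContraction.RealHyperellipticSector.Port

namespace Dlog

/-! ## The carrier family inside the budget -/

/-- `Λ(1, c) ∈ relationsLE 1` (empty slab) (inside the budget `relationsLE 1`).
[cite: KontsevichZagier2001, §1.2 rule (1)] -/
theorem carrierA_one_mem_relationsLE {R : ℝ → ℝ → ℝ → IntegralRep 1}
    (hR : ∀ a b c, IsAlgebraic ℚ a → IsAlgebraic ℚ b → IsAlgebraic ℚ c → 0 < a →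
      (R a b c).domain = {x | x 0 ∈ Set.Ioo a b} ∧ (R a b c).integrand = fun x => c / x 0)
    {c : ℝ} (hc : IsAlgebraic ℚ c) : of (R 1 1 c) ∈ relationsLE 1 :=
  slab_empty_mem_relationsLE _ (hR 1 1 c isAlgebraic_one isAlgebraic_one hc one_pos).1 le_rfl

/-- **Powers**: `Λ(uⁿ, c) = n • Λ(u, c)` in `FormalRep ⧸ relationsLE 1` for algebraic `u ≥ 1`
(inside the budget `relationsLE 1`). [cite: KontsevichZagier2001, §1.2 rules (1), (2)] -/
theorem carrierA_pow_eq {R : ℝ → ℝ → ℝ → IntegralRep 1}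
    (hR : ∀ a b c, IsAlgebraic ℚ a → IsAlgebraic ℚ b → IsAlgebraic ℚ c → 0 < a →
      (R a b c).domain = {x | x 0 ∈ Set.Ioo a b} ∧ (R a b c).integrand = fun x => c / x 0)
    {u c : ℝ} (hu : IsAlgebraic ℚ u) (hc : IsAlgebraic ℚ c) (hu1 : 1 ≤ u) (n : ℕ) :
    QuotientAddGroup.mk' (relationsLE 1) (of (R 1 (u ^ n) c)) =
      n • QuotientAddGroup.mk' (relationsLE 1) (of (R 1 u c)) := by
  induction n with
  | zero =>
    rw [pow_zero, zero_smul]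
    exact (QuotientAddGroup.eq_zero_iff _).mpr (carrierA_one_mem_relationsLE hR hc)
  | succ n ih =>
    have h := CarrierSiegeK8.carrierA_mul_mem_relationsLE hR (hu.pow n) hu hc (one_le_pow₀ hu1) hu1
    rw [← QuotientAddGroup.eq_zero_iff] at h
    change QuotientAddGroup.mk' (relationsLE 1) _ = 0 at h
    rw [map_sub, map_sub, sub_sub, sub_eq_zero] at h
    rw [pow_succ, h, ih, add_smul, one_smul]

/-- **Additivity in the constant**: `Λ(u, c + c') − Λ(u, c) − Λ(u, c') ∈ relationsLE 1`
(inside the budget `relationsLE 1`). [cite: KontsevichZagier2001, §1.2 rule (1)] -/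
theorem carrierA_add_mem_relationsLE {R : ℝ → ℝ → ℝ → IntegralRep 1}
    (hR : ∀ a b c, IsAlgebraic ℚ a → IsAlgebraic ℚ b → IsAlgebraic ℚ c → 0 < a →
      (R a b c).domain = {x | x 0 ∈ Set.Ioo a b} ∧ (R a b c).integrand = fun x => c / x 0)
    {u c c' : ℝ} (hu : IsAlgebraic ℚ u) (hc : IsAlgebraic ℚ c) (hc' : IsAlgebraic ℚ c') :
    of (R 1 u (c + c')) - of (R 1 u c) - of (R 1 u c') ∈ relationsLE 1 :=
  dlogA_merge_mem_relationsLE (σ := {x | x 0 ∈ Set.Ioo (1:ℝ) u}) (c := c) (c' := c') _ _ _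
    (hR 1 u (c + c') isAlgebraic_one hu (hc.add hc') one_pos).1
    (hR 1 u c isAlgebraic_one hu hc one_pos).1 (hR 1 u c' isAlgebraic_one hu hc' one_pos).1
    (by rw [(hR 1 u (c + c') isAlgebraic_one hu (hc.add hc') one_pos).2]; exact fun _ _ => rfl)
    (by rw [(hR 1 u c isAlgebraic_one hu hc one_pos).2]; exact fun _ _ => rfl)
    (by rw [(hR 1 u c' isAlgebraic_one hu hc' one_pos).2]; exact fun _ _ => rfl)

/-- `Λ(u, 0) ∈ relationsLE 1` (inside the budget `relationsLE 1`).
[cite: KontsevichZagier2001, §1.2 rule (1)] -/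
theorem carrierA_zero_mem_relationsLE {R : ℝ → ℝ → ℝ → IntegralRep 1}
    (hR : ∀ a b c, IsAlgebraic ℚ a → IsAlgebraic ℚ b → IsAlgebraic ℚ c → 0 < a →
      (R a b c).domain = {x | x 0 ∈ Set.Ioo a b} ∧ (R a b c).integrand = fun x => c / x 0)
    {u : ℝ} (hu : IsAlgebraic ℚ u) : of (R 1 u 0) ∈ relationsLE 1 :=
  dlogA_zero_mem_relationsLE _
    (by rw [(hR 1 u 0 isAlgebraic_one hu isAlgebraic_zero one_pos).2]; exact fun _ _ => rfl)

/-- Additivity in the quotient `FormalRep ⧸ relationsLE 1` (inside the budget `relationsLE 1`).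
[cite: KontsevichZagier2001, §1.2 rule (1)] -/
theorem carrierA_add_eq {R : ℝ → ℝ → ℝ → IntegralRep 1}
    (hR : ∀ a b c, IsAlgebraic ℚ a → IsAlgebraic ℚ b → IsAlgebraic ℚ c → 0 < a →
      (R a b c).domain = {x | x 0 ∈ Set.Ioo a b} ∧ (R a b c).integrand = fun x => c / x 0)
    {u c c' : ℝ} (hu : IsAlgebraic ℚ u) (hc : IsAlgebraic ℚ c) (hc' : IsAlgebraic ℚ c') :
    QuotientAddGroup.mk' (relationsLE 1) (of (R 1 u (c + c'))) =
      QuotientAddGroup.mk' (relationsLE 1) (of (R 1 u c)) +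
        QuotientAddGroup.mk' (relationsLE 1) (of (R 1 u c')) := by
  have h := carrierA_add_mem_relationsLE hR hu hc hc'
  rw [← QuotientAddGroup.eq_zero_iff] at h
  change QuotientAddGroup.mk' (relationsLE 1) _ = 0 at h
  rwa [map_sub, map_sub, sub_sub, sub_eq_zero] at h

/-- Negation in the quotient: `Λ(u, −c) = −Λ(u, c)` in `FormalRep ⧸ relationsLE 1`
(inside the budget `relationsLE 1`). [cite: KontsevichZagier2001, §1.2 rule (1)] -/
theorem carrierA_neg_eq {R : ℝ → ℝ → ℝ → IntegralRep 1}
    (hR : ∀ a b c, IsAlgebraic ℚ a → IsAlgebraic ℚ b → IsAlgebraic ℚ c → 0 < a →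
      (R a b c).domain = {x | x 0 ∈ Set.Ioo a b} ∧ (R a b c).integrand = fun x => c / x 0)
    {u c : ℝ} (hu : IsAlgebraic ℚ u) (hc : IsAlgebraic ℚ c) :
    QuotientAddGroup.mk' (relationsLE 1) (of (R 1 u (-c))) =
      -QuotientAddGroup.mk' (relationsLE 1) (of (R 1 u c)) := by
  have h := carrierA_add_eq hR hu hc hc.neg
  have h0 : QuotientAddGroup.mk' (relationsLE 1) (of (R 1 u 0)) = 0 :=
    (QuotientAddGroup.eq_zero_iff _).mpr (carrierA_zero_mem_relationsLE hR hu)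
  rw [add_neg_cancel, h0] at h
  exact (neg_eq_of_add_eq_zero_right h.symm).symm

/-- Integer multiples: `z • Λ(u, c) = Λ(u, z c)` in `FormalRep ⧸ relationsLE 1`
(inside the budget `relationsLE 1`). [cite: KontsevichZagier2001, §1.2 rule (1)] -/
theorem carrierA_zsmul_eq {R : ℝ → ℝ → ℝ → IntegralRep 1}
    (hR : ∀ a b c, IsAlgebraic ℚ a → IsAlgebraic ℚ b → IsAlgebraic ℚ c → 0 < a →
      (R a b c).domain = {x | x 0 ∈ Set.Ioo a b} ∧ (R a b c).integrand = fun x => c / x 0)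
    {u c : ℝ} (hu : IsAlgebraic ℚ u) (hc : IsAlgebraic ℚ c) (z : ℤ) :
    z • QuotientAddGroup.mk' (relationsLE 1) (of (R 1 u c)) =
      QuotientAddGroup.mk' (relationsLE 1) (of (R 1 u ((z:ℝ) * c))) := by
  -- natural multiples first
  have hnat : ∀ n : ℕ, n • QuotientAddGroup.mk' (relationsLE 1) (of (R 1 u c)) =
      QuotientAddGroup.mk' (relationsLE 1) (of (R 1 u ((n:ℝ) * c))) := by
    intro n
    induction n with
    | zero =>
      rw [zero_smul, Nat.cast_zero, zero_mul]
      exact ((QuotientAddGroup.eq_zero_iff _).mpr (carrierA_zero_mem_relationsLE hR hu)).symm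
    | succ n ih =>
      rw [add_smul, one_smul, ih, Nat.cast_succ, add_mul, one_mul,
        carrierA_add_eq hR hu ((isAlgebraic_nat (R := ℚ) n).mul hc) hc]
  cases z with
  | ofNat n =>
    rw [Int.ofNat_eq_natCast, natCast_zsmul, hnat n, Int.cast_natCast]
  | negSucc n =>
    rw [negSucc_zsmul, hnat (n + 1), Int.cast_negSucc, neg_mul,
      carrierA_neg_eq hR hu ((isAlgebraic_nat (R := ℚ) (n + 1)).mul hc)]

/-- Finite sums in the constant: `Λ(u, Σᵢ fᵢ) = Σᵢ Λ(u, fᵢ)` in `FormalRep ⧸ relationsLE 1` for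
algebraic `fᵢ` (inside the budget `relationsLE 1`). [cite: KontsevichZagier2001, §1.2 rule (1)] -/
theorem carrierA_sum_eq {R : ℝ → ℝ → ℝ → IntegralRep 1} {ι : Type*} (s : Finset ι) (f : ι → ℝ)
    (hR : ∀ a b c, IsAlgebraic ℚ a → IsAlgebraic ℚ b → IsAlgebraic ℚ c → 0 < a →
      (R a b c).domain = {x | x 0 ∈ Set.Ioo a b} ∧ (R a b c).integrand = fun x => c / x 0)
    {u : ℝ} (hu : IsAlgebraic ℚ u) (hf : ∀ i ∈ s, IsAlgebraic ℚ (f i)) :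
    QuotientAddGroup.mk' (relationsLE 1) (of (R 1 u (∑ i ∈ s, f i))) =
      ∑ i ∈ s, QuotientAddGroup.mk' (relationsLE 1) (of (R 1 u (f i))) := by
  classical
  induction s using Finset.induction_on with
  | empty =>
    rw [Finset.sum_empty, Finset.sum_empty]
    exact (QuotientAddGroup.eq_zero_iff _).mpr (carrierA_zero_mem_relationsLE hR hu)
  | insert i s hi ih =>
    rw [Finset.sum_insert hi, Finset.sum_insert hi,
      carrierA_add_eq hR hu (hf i (Finset.mem_insert_self i s))
        (Finset.sum_induction _ (IsAlgebraic ℚ) (fun _ _ ha hb => ha.add hb) isAlgebraic_zero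
          fun j hj => hf j (Finset.mem_insert_of_mem hj)),
      ih fun j hj => hf j (Finset.mem_insert_of_mem hj)]

/-- **An interval on one carrier** (inside the budget `relationsLE 1`; registered sub-goal of crux
stmt-KontsevichZagierPeriods-12475, port of `PiBox.Dlog.carrierA_interval_eq`): for real algebraic
`0 < a < b` and algebraic `c`, `[(a,b), c/y] = Λ(b/a, c)` in `FormalRep ⧸ relationsLE 1` (scale
by `a⁻¹`, one rule-(2) move among representations of dimension `1`).
[cite: KontsevichZagier2001, §1.2 rule (2)] -/
theorem carrierA_interval_eq : ∀ {R : ℝ → ℝ → ℝ → KZ.IntegralRep 1},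
    (∀ a b c, IsAlgebraic ℚ a → IsAlgebraic ℚ b → IsAlgebraic ℚ c → 0 < a →
      (R a b c).domain = {x | x 0 ∈ Set.Ioo a b} ∧ (R a b c).integrand = fun x => c / x 0) →
    ∀ {a b c : ℝ}, IsAlgebraic ℚ a → IsAlgebraic ℚ b → IsAlgebraic ℚ c → 0 < a →
    ∀ (L : KZ.IntegralRep 1), L.domain = {x | x 0 ∈ Set.Ioo a b} →
    Set.EqOn L.integrand (fun x => c / x 0) L.domain →
    QuotientAddGroup.mk' (KZ.relationsLE 1) (KZ.of L) =
      QuotientAddGroup.mk' (KZ.relationsLE 1) (KZ.of (R 1 (b / a) c)) := by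
  intro R hR a b c ha hb hc ha0 L hd hi
  have h1 := hR 1 (b / a) c isAlgebraic_one (hb.mul ha.inv) hc one_pos
  have hscale : of L - of (R 1 (b / a) c) ∈ relationsLE 1 :=
    dlogA_scale_mem_relationsLE (s := a⁻¹) ha.inv L _ hd
      (by rw [h1.1, inv_mul_cancel₀ ha0.ne', ← div_eq_inv_mul]) hi
      (by rw [h1.2]; exact fun _ _ => rfl) ha0 (inv_pos.mpr ha0)
  rw [← QuotientAddGroup.eq_zero_iff] at hscale
  change QuotientAddGroup.mk' (relationsLE 1) _ = 0 at hscale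
  rwa [map_sub, sub_eq_zero] at hscale

end Dlog

end Summit.KontsevichZagierPeriods.AbelContraction.RealHyperellipticSector.Port

end
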